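import Mathlib

/-!
# Route PhotonSphereChannels — energy–flux calculus for `C²` solutions of `u_tt − u_xx + V u = 0` (I)

The three linear items of route `PhotonSphereChannels` (`UniformPhotonSphereChannels` = K1,
`FixedModeChannels`, `BlindnessInsidePhotonSphere`) are statements about energies
`∫ (ψ_t² + ψ_x² + V ψ²) dx` of `C²` solutions of the 1+1 Regge–Wheeler equation
`ψ_tt − ψ_xx + V(x) ψ = 0` on receding exterior regions `{ρ + |t| < |x − x_c|}`.  Every formal
treatment of these items (a proof of the fixed-mode inequality, the refutation of K1 recorded on
item stmt-FinalStateConjecture-10045 — whose "Lemma A" is exactly the monotonicity of the exterior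
energy in `|t|` —, or the construction in `BlindnessInsidePhotonSphere`) needs the elementary
energy–flux calculus of the equation, which Mathlib does not have.  This file supplies its core,
for a general differentiable potential `V : ℝ → ℝ` and a general `C²` function
`u : ℝ × ℝ → ℝ`, `z = (t, x)`, written with Fréchet partials
`u_t = ∂u(z)(1,0)`, `u_x = ∂u(z)(0,1)`, `u_tt = ∂²u(z)(1,0)(1,0)`, `u_xx = ∂²u(z)(0,1)(0,1)`:

* slice/partial-derivative bookkeeping for `C²` functions on `ℝ × ℝ` (symmetry of mixed partials
  from `ContDiffAt.isSymmSndFDerivAt`);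
* the local conservation law `∂ₜ e = ∂ₓ m` for the energy density `e = u_t² + u_x² + V u²` and the
  momentum density `m = 2 u_t u_x` (`fderiv_energyDensity_eq`);
* the **energy identity with affinely moving ends** (`energy_identity_affine`): for
  `α(t) = a₀ + a₁ t`, `β(t) = b₀ + b₁ t`,
  `∫_{α t₂}^{β t₂} e(t₂,·) − ∫_{α t₁}^{β t₁} e(t₁,·) = ∫_{t₁}^{t₂} [(m + b₁ e)(t, β t) − (m + a₁ e)(t, α t)] dt`,
  obtained from Mathlib's Green formula on rectangles
  (`MeasureTheory.integral2_divergence_prod_of_hasFDerivAt`) after pulling the quadrilateral back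
  to the box `[t₁, t₂] × [0, 1]`.

The energy/momentum densities are passed as functions `e m` together with defining hypotheses
`he hm` (no new definitions are introduced).  The domain-of-dependence inequalities, the
exterior-cone monotonicity in the route's own (curried, `deriv`/`iteratedDeriv`) vocabulary and
the Regge–Wheeler specialisation are in the sequel files `PhotonSphereChannelsEnergyInequalities`
and `PhotonSphereChannelsExteriorEnergy`.  Standard material [folklore]; no source formalises it.
-/

namespace Summit.FinalStateConjecture.FinalStateConjecture.Theorems

open MeasureTheory Set Filter Topology intervalIntegral

noncomputable section

namespace WaveEnergy

variable {u : ℝ × ℝ → ℝ}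

/-- A `C²` function on `ℝ × ℝ` is differentiable. -/
theorem differentiable_of_contDiff_two (hu : ContDiff ℝ 2 u) : Differentiable ℝ u :=
  hu.differentiable (by norm_num)

/-- The derivative of a `C²` function on `ℝ × ℝ` is differentiable. -/
theorem differentiable_fderiv_of_contDiff_two (hu : ContDiff ℝ 2 u) :
    Differentiable ℝ (fderiv ℝ u) :=
  (hu.fderiv_right (m := 1) (by norm_num)).differentiable (by norm_num)

/-- The derivative of a `C²` function on `ℝ × ℝ` is continuous. -/
theorem continuous_fderiv_of_contDiff_two (hu : ContDiff ℝ 2 u) :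
    Continuous (fderiv ℝ u) :=
  hu.continuous_fderiv (by norm_num)

/-- `t`-slices: `τ ↦ u (τ, x)` has derivative `∂u(t,x)(1,0)`. -/
theorem hasDerivAt_slice_fst (hu : Differentiable ℝ u) (t x : ℝ) :
    HasDerivAt (fun τ => u (τ, x)) (fderiv ℝ u (t, x) (1, 0)) t := by
  have h1 : HasDerivAt (fun τ : ℝ => (τ, x)) ((1 : ℝ), (0 : ℝ)) t :=
    (hasDerivAt_id t).prodMk (hasDerivAt_const t x)
  exact (hu (t, x)).hasFDerivAt.comp_hasDerivAt t h1

/-- `x`-slices: `y ↦ u (t, y)` has derivative `∂u(t,x)(0,1)`. -/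
theorem hasDerivAt_slice_snd (hu : Differentiable ℝ u) (t x : ℝ) :
    HasDerivAt (fun y => u (t, y)) (fderiv ℝ u (t, x) (0, 1)) x := by
  have h1 : HasDerivAt (fun y : ℝ => (t, y)) ((0 : ℝ), (1 : ℝ)) x :=
    (hasDerivAt_const x t).prodMk (hasDerivAt_id x)
  exact (hu (t, x)).hasFDerivAt.comp_hasDerivAt x h1

/-- Along a differentiable curve `γ`, `u ∘ γ` has derivative `∂u(γ s)(γ' s)`. -/
theorem hasDerivAt_comp_curve (hu : Differentiable ℝ u) {γ : ℝ → ℝ × ℝ} {γ' : ℝ × ℝ} {s : ℝ}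
    (hγ : HasDerivAt γ γ' s) : HasDerivAt (fun σ => u (γ σ)) (fderiv ℝ u (γ s) γ') s :=
  (hu (γ s)).hasFDerivAt.comp_hasDerivAt s hγ

/-- The directional derivative `z ↦ ∂u(z)(v)` of a `C²` function has derivative
`w ↦ ∂²u(z)(w)(v)`. -/
theorem hasFDerivAt_fderiv_apply (hu : ContDiff ℝ 2 u) (z v : ℝ × ℝ) :
    HasFDerivAt (fun z => fderiv ℝ u z v) ((fderiv ℝ (fderiv ℝ u) z).flip v) z := by
  have h := ((differentiable_fderiv_of_contDiff_two hu) z).hasFDerivAt.clm_apply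
    (hasFDerivAt_const v z)
  simpa using h

/-- The directional derivative `z ↦ ∂u(z)(v)` of a `C²` function is differentiable. -/
theorem differentiable_fderiv_apply (hu : ContDiff ℝ 2 u) (v : ℝ × ℝ) :
    Differentiable ℝ (fun z => fderiv ℝ u z v) :=
  fun z => (hasFDerivAt_fderiv_apply hu z v).differentiableAt

/-- The directional derivative `z ↦ ∂u(z)(v)` of a `C²` function is continuous. -/
theorem continuous_fderiv_apply (hu : ContDiff ℝ 2 u) (v : ℝ × ℝ) :
    Continuous (fun z => fderiv ℝ u z v) :=
  (continuous_fderiv_of_contDiff_two hu).clm_apply continuous_const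

/-- Second derivatives as derivatives of directional derivatives:
`∂(z ↦ ∂u(z)(v))(z)(w) = ∂²u(z)(w)(v)`. -/
theorem fderiv_fderiv_apply (hu : ContDiff ℝ 2 u) (z v w : ℝ × ℝ) :
    fderiv ℝ (fun z => fderiv ℝ u z v) z w = fderiv ℝ (fderiv ℝ u) z w v := by
  rw [(hasFDerivAt_fderiv_apply hu z v).fderiv]
  rfl

/-- Symmetry of second partial derivatives of a `C²` function on `ℝ × ℝ`. -/
theorem fderiv_fderiv_symm (hu : ContDiff ℝ 2 u) (z v w : ℝ × ℝ) :
    fderiv ℝ (fderiv ℝ u) z v w = fderiv ℝ (fderiv ℝ u) z w v :=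
  (hu.contDiffAt.isSymmSndFDerivAt (by simp)) v w

/-- `t`-slice of a first partial: `τ ↦ ∂u(τ,x)(v)` has derivative `∂²u(t,x)(1,0)(v)`. -/
theorem hasDerivAt_fderiv_apply_slice_fst (hu : ContDiff ℝ 2 u) (v : ℝ × ℝ) (t x : ℝ) :
    HasDerivAt (fun τ => fderiv ℝ u (τ, x) v) (fderiv ℝ (fderiv ℝ u) (t, x) (1, 0) v) t := by
  have h := hasDerivAt_slice_fst (differentiable_fderiv_apply hu v) t x
  rwa [fderiv_fderiv_apply hu] at h

/-- `x`-slice of a first partial: `y ↦ ∂u(t,y)(v)` has derivative `∂²u(t,x)(0,1)(v)`. -/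
theorem hasDerivAt_fderiv_apply_slice_snd (hu : ContDiff ℝ 2 u) (v : ℝ × ℝ) (t x : ℝ) :
    HasDerivAt (fun y => fderiv ℝ u (t, y) v) (fderiv ℝ (fderiv ℝ u) (t, x) (0, 1) v) x := by
  have h := hasDerivAt_slice_snd (differentiable_fderiv_apply hu v) t x
  rwa [fderiv_fderiv_apply hu] at h

/-! ### The pointwise conservation law `∂ₜ e = ∂ₓ m` -/

variable {V : ℝ → ℝ}

/-- The energy density `e = u_t² + u_x² + V u²` (given by the hypothesis `he`) is differentiable
on `ℝ × ℝ` when `u` is `C²` and `V` is differentiable. -/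
theorem differentiable_energyDensity (hu : ContDiff ℝ 2 u) (hV : Differentiable ℝ V)
    {e : ℝ × ℝ → ℝ}
    (he : ∀ z, e z = (fderiv ℝ u z (1, 0)) ^ 2 + (fderiv ℝ u z (0, 1)) ^ 2 + V z.2 * u z ^ 2) :
    Differentiable ℝ e := by
  have h1 := differentiable_fderiv_apply hu (1, 0)
  have h2 := differentiable_fderiv_apply hu (0, 1)
  have h3 := differentiable_of_contDiff_two hu
  have h4 : Differentiable ℝ (fun z : ℝ × ℝ => V z.2) := hV.comp differentiable_snd
  have : e = fun z => (fderiv ℝ u z (1, 0)) ^ 2 + (fderiv ℝ u z (0, 1)) ^ 2 + V z.2 * u z ^ 2 :=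
    funext he
  rw [this]
  exact ((h1.pow 2).add (h2.pow 2)).add (h4.mul (h3.pow 2))

/-- The momentum density `m = 2 u_t u_x` (given by the hypothesis `hm`) is differentiable on
`ℝ × ℝ` when `u` is `C²`. -/
theorem differentiable_momentumDensity (hu : ContDiff ℝ 2 u) {m : ℝ × ℝ → ℝ}
    (hm : ∀ z, m z = 2 * fderiv ℝ u z (1, 0) * fderiv ℝ u z (0, 1)) :
    Differentiable ℝ m := by
  have h1 := differentiable_fderiv_apply hu (1, 0)
  have h2 := differentiable_fderiv_apply hu (0, 1)
  have : m = fun z => 2 * fderiv ℝ u z (1, 0) * fderiv ℝ u z (0, 1) := funext hm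
  rw [this]
  exact ((differentiable_const _).mul h1).mul h2

/-- The energy density is continuous. -/
theorem continuous_energyDensity (hu : ContDiff ℝ 2 u) (hV : Differentiable ℝ V)
    {e : ℝ × ℝ → ℝ}
    (he : ∀ z, e z = (fderiv ℝ u z (1, 0)) ^ 2 + (fderiv ℝ u z (0, 1)) ^ 2 + V z.2 * u z ^ 2) :
    Continuous e :=
  (differentiable_energyDensity hu hV he).continuous

/-- The momentum density is continuous. -/
theorem continuous_momentumDensity (hu : ContDiff ℝ 2 u) {m : ℝ × ℝ → ℝ}
    (hm : ∀ z, m z = 2 * fderiv ℝ u z (1, 0) * fderiv ℝ u z (0, 1)) :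
    Continuous m :=
  (differentiable_momentumDensity hu hm).continuous

/-- `∂ₜ e` along a `t`-slice: `τ ↦ e (τ, x)` has derivative
`2 u_t u_tt + 2 u_x u_xt + 2 V u u_t` (second partials as `∂²u (1,0) (·)`). -/
theorem hasDerivAt_energyDensity_slice_fst (hu : ContDiff ℝ 2 u) {e : ℝ × ℝ → ℝ}
    (he : ∀ z, e z = (fderiv ℝ u z (1, 0)) ^ 2 + (fderiv ℝ u z (0, 1)) ^ 2 + V z.2 * u z ^ 2)
    (t x : ℝ) :
    HasDerivAt (fun τ => e (τ, x))
      (2 * fderiv ℝ u (t, x) (1, 0) * fderiv ℝ (fderiv ℝ u) (t, x) (1, 0) (1, 0)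
        + 2 * fderiv ℝ u (t, x) (0, 1) * fderiv ℝ (fderiv ℝ u) (t, x) (1, 0) (0, 1)
        + V x * (2 * u (t, x) * fderiv ℝ u (t, x) (1, 0))) t := by
  have h1 := hasDerivAt_fderiv_apply_slice_fst hu (1, 0) t x
  have h2 := hasDerivAt_fderiv_apply_slice_fst hu (0, 1) t x
  have h3 := hasDerivAt_slice_fst (differentiable_of_contDiff_two hu) t x
  have h := ((h1.pow 2).add (h2.pow 2)).add ((h3.pow 2).const_mul (V x))
  have hfun : (fun τ => e (τ, x)) = fun τ =>
      (fderiv ℝ u (τ, x) (1, 0)) ^ 2 + (fderiv ℝ u (τ, x) (0, 1)) ^ 2 + V x * u (τ, x) ^ 2 :=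
    funext fun τ => he (τ, x)
  rw [hfun]
  refine h.congr_deriv ?_
  push_cast
  ring

/-- `∂ₓ m` along an `x`-slice: `y ↦ m (t, y)` has derivative `2 (u_tx u_x + u_t u_xx)`
(second partials as `∂²u (0,1) (·)`). -/
theorem hasDerivAt_momentumDensity_slice_snd (hu : ContDiff ℝ 2 u) {m : ℝ × ℝ → ℝ}
    (hm : ∀ z, m z = 2 * fderiv ℝ u z (1, 0) * fderiv ℝ u z (0, 1)) (t x : ℝ) :
    HasDerivAt (fun y => m (t, y))
      (2 * (fderiv ℝ (fderiv ℝ u) (t, x) (0, 1) (1, 0) * fderiv ℝ u (t, x) (0, 1)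
        + fderiv ℝ u (t, x) (1, 0) * fderiv ℝ (fderiv ℝ u) (t, x) (0, 1) (0, 1))) x := by
  have h1 := hasDerivAt_fderiv_apply_slice_snd hu (1, 0) t x
  have h2 := hasDerivAt_fderiv_apply_slice_snd hu (0, 1) t x
  have h := (h1.mul h2).const_mul 2
  have hfun : (fun y => m (t, y)) = fun y => 2 * (fderiv ℝ u (t, y) (1, 0) * fderiv ℝ u (t, y) (0, 1)) :=
    funext fun y => by rw [hm]; ring
  rw [hfun]
  refine h.congr_deriv ?_
  ring

/-- **Local energy conservation.** For a `C²` solution of `u_tt − u_xx + V u = 0`,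
`∂ₜ e = ∂ₓ m` pointwise, i.e. `∂e(z)(1,0) = ∂m(z)(0,1)`. -/
theorem fderiv_energyDensity_eq (hu : ContDiff ℝ 2 u) (hV : Differentiable ℝ V)
    (hsol : ∀ z : ℝ × ℝ, fderiv ℝ (fderiv ℝ u) z (1, 0) (1, 0)
      - fderiv ℝ (fderiv ℝ u) z (0, 1) (0, 1) + V z.2 * u z = 0)
    {e m : ℝ × ℝ → ℝ}
    (he : ∀ z, e z = (fderiv ℝ u z (1, 0)) ^ 2 + (fderiv ℝ u z (0, 1)) ^ 2 + V z.2 * u z ^ 2)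
    (hm : ∀ z, m z = 2 * fderiv ℝ u z (1, 0) * fderiv ℝ u z (0, 1)) (z : ℝ × ℝ) :
    fderiv ℝ e z (1, 0) = fderiv ℝ m z (0, 1) := by
  obtain ⟨t, x⟩ := z
  have hE := (hasDerivAt_slice_fst (differentiable_energyDensity hu hV he) t x).unique
    (hasDerivAt_energyDensity_slice_fst hu he t x)
  have hM := (hasDerivAt_slice_snd (differentiable_momentumDensity hu hm) t x).unique
    (hasDerivAt_momentumDensity_slice_snd hu hm t x)
  rw [hE, hM]
  have hsymm := fderiv_fderiv_symm hu (t, x) (1, 0) (0, 1)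
  have hs := hsol (t, x)
  simp only at hs
  linear_combination (2 * fderiv ℝ u (t, x) (1, 0)) * hs
    + (2 * fderiv ℝ u (t, x) (0, 1)) * hsymm

/-! ### The energy identity on a quadrilateral with affinely moving ends -/

/-- Linearity helper: `φ (1, c) = φ (1, 0) + c * φ (0, 1)` for a linear functional on `ℝ × ℝ`. -/
theorem clm_apply_one_snd (φ : ℝ × ℝ →L[ℝ] ℝ) (c : ℝ) :
    φ (1, c) = φ (1, 0) + c * φ (0, 1) := by
  have : ((1 : ℝ), c) = ((1 : ℝ), (0 : ℝ)) + c • ((0 : ℝ), (1 : ℝ)) := by ext <;> simp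
  rw [this, map_add, map_smul, smul_eq_mul]

/-- Linearity helper: `φ (0, c) = c * φ (0, 1)` for a linear functional on `ℝ × ℝ`. -/
theorem clm_apply_zero_snd (φ : ℝ × ℝ →L[ℝ] ℝ) (c : ℝ) :
    φ (0, c) = c * φ (0, 1) := by
  have : ((0 : ℝ), c) = c • ((0 : ℝ), (1 : ℝ)) := by ext <;> simp
  rw [this, map_smul, smul_eq_mul]

/-- **Energy identity with affinely moving ends.** Let `u` be a `C²` solution of
`u_tt − u_xx + V u = 0` on `ℝ × ℝ` (`V` differentiable), `e = u_t² + u_x² + V u²` the energy density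
and `m = 2 u_t u_x` the momentum density. For the moving interval `[α(t), β(t)]`,
`α(t) = a₀ + a₁ t`, `β(t) = b₀ + b₁ t`, the energy `E(t) = ∫_{α(t)}^{β(t)} e(t,x) dx` satisfies
`E(t₂) − E(t₁) = ∫_{t₁}^{t₂} [(m + b₁ e)(t, β t) − (m + a₁ e)(t, α t)] dt`
(oriented interval integrals throughout, no ordering hypotheses). Proof: Green's formula on the box
`[t₁,t₂] × [0,1]` (Mathlib's `integral2_divergence_prod_of_hasFDerivAt`) for the pulled-back pair
`F(t,θ) = L(t) e(t, X)`, `G(t,θ) = −(m(t,X) + ∂ₜX · e(t,X))`, `X = α(t) + L(t) θ`, `L = β − α`,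
whose divergence is `L · (∂ₜe − ∂ₓm) ∘ X = 0` by local energy conservation. [folklore] -/
theorem energy_identity_affine (hu : ContDiff ℝ 2 u) (hV : Differentiable ℝ V)
    (hsol : ∀ z : ℝ × ℝ, fderiv ℝ (fderiv ℝ u) z (1, 0) (1, 0)
      - fderiv ℝ (fderiv ℝ u) z (0, 1) (0, 1) + V z.2 * u z = 0)
    {e m : ℝ × ℝ → ℝ}
    (he : ∀ z, e z = (fderiv ℝ u z (1, 0)) ^ 2 + (fderiv ℝ u z (0, 1)) ^ 2 + V z.2 * u z ^ 2)
    (hm : ∀ z, m z = 2 * fderiv ℝ u z (1, 0) * fderiv ℝ u z (0, 1))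
    (a₀ a₁ b₀ b₁ t₁ t₂ : ℝ) :
    (∫ x in (a₀ + a₁ * t₂)..(b₀ + b₁ * t₂), e (t₂, x))
        - ∫ x in (a₀ + a₁ * t₁)..(b₀ + b₁ * t₁), e (t₁, x)
      = ∫ t in t₁..t₂, ((m (t, b₀ + b₁ * t) + b₁ * e (t, b₀ + b₁ * t))
          - (m (t, a₀ + a₁ * t) + a₁ * e (t, a₀ + a₁ * t))) := by
  have hed := differentiable_energyDensity hu hV he
  have hmd := differentiable_momentumDensity hu hm
  have hec := hed.continuous
  have hmc := hmd.continuous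
  have hcons := fderiv_energyDensity_eq hu hV hsol he hm
  -- the pulled-back pair on the box `[t₁, t₂] × [0, 1]`
  set F : ℝ × ℝ → ℝ := fun p =>
    (b₀ + b₁ * p.1 - (a₀ + a₁ * p.1)) * e (p.1, (b₀ + b₁ * p.1 - (a₀ + a₁ * p.1)) * p.2
      + (a₀ + a₁ * p.1)) with hF
  set G : ℝ × ℝ → ℝ := fun p =>
    -(m (p.1, (b₀ + b₁ * p.1 - (a₀ + a₁ * p.1)) * p.2 + (a₀ + a₁ * p.1))
      + (a₁ + (b₁ - a₁) * p.2) * e (p.1, (b₀ + b₁ * p.1 - (a₀ + a₁ * p.1)) * p.2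
        + (a₀ + a₁ * p.1))) with hG
  have hFd : Differentiable ℝ F := by
    simp only [hF]
    fun_prop
  have hGd : Differentiable ℝ G := by
    simp only [hG]
    fun_prop
  -- divergence of `(F, G)` vanishes
  have hdiv : ∀ t θ : ℝ, fderiv ℝ F (t, θ) (1, 0) + fderiv ℝ G (t, θ) (0, 1) = 0 := by
    intro t θ
    -- affine pieces and their derivatives
    have haff : ∀ (p q s : ℝ), HasDerivAt (fun τ : ℝ => p + q * τ) q s := fun p q s => by
      simpa using ((hasDerivAt_id s).const_mul q).const_add p
    have hL : HasDerivAt (fun τ : ℝ => b₀ + b₁ * τ - (a₀ + a₁ * τ)) (b₁ - a₁) t :=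
      (haff b₀ b₁ t).fun_sub (haff a₀ a₁ t)
    have hX : HasDerivAt (fun τ : ℝ => (b₀ + b₁ * τ - (a₀ + a₁ * τ)) * θ + (a₀ + a₁ * τ))
        ((b₁ - a₁) * θ + a₁) t :=
      (hL.mul_const θ).fun_add (haff a₀ a₁ t)
    have hγ : HasDerivAt (fun τ : ℝ => (τ, (b₀ + b₁ * τ - (a₀ + a₁ * τ)) * θ + (a₀ + a₁ * τ)))
        ((1 : ℝ), (b₁ - a₁) * θ + a₁) t := (hasDerivAt_id' t).prodMk hX
    have hY : HasDerivAt (fun θ' : ℝ => (b₀ + b₁ * t - (a₀ + a₁ * t)) * θ' + (a₀ + a₁ * t))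
        (b₀ + b₁ * t - (a₀ + a₁ * t)) θ := by
      simpa using ((hasDerivAt_id θ).const_mul (b₀ + b₁ * t - (a₀ + a₁ * t))).add_const
        (a₀ + a₁ * t)
    have hδ : HasDerivAt (fun θ' : ℝ => (t, (b₀ + b₁ * t - (a₀ + a₁ * t)) * θ' + (a₀ + a₁ * t)))
        ((0 : ℝ), (b₀ + b₁ * t - (a₀ + a₁ * t))) θ := (hasDerivAt_const θ t).prodMk hY
    have hcoef : HasDerivAt (fun θ' : ℝ => a₁ + (b₁ - a₁) * θ') (b₁ - a₁) θ := haff a₁ (b₁ - a₁) θ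
    -- slices of `F` and `G`
    set Xv : ℝ := (b₀ + b₁ * t - (a₀ + a₁ * t)) * θ + (a₀ + a₁ * t) with hXv
    have hFs : HasDerivAt (fun τ => F (τ, θ))
        ((b₁ - a₁) * e (t, Xv) + (b₀ + b₁ * t - (a₀ + a₁ * t))
          * fderiv ℝ e (t, Xv) ((1 : ℝ), (b₁ - a₁) * θ + a₁)) t := by
      have h := hL.fun_mul (hasDerivAt_comp_curve hed hγ)
      exact h
    have hGs : HasDerivAt (fun θ' => G (t, θ'))
        (-(fderiv ℝ m (t, Xv) ((0 : ℝ), (b₀ + b₁ * t - (a₀ + a₁ * t)))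
          + ((b₁ - a₁) * e (t, Xv)
            + (a₁ + (b₁ - a₁) * θ)
              * fderiv ℝ e (t, Xv) ((0 : ℝ), (b₀ + b₁ * t - (a₀ + a₁ * t)))))) θ := by
      have h := ((hasDerivAt_comp_curve hmd hδ).fun_add
        (hcoef.fun_mul (hasDerivAt_comp_curve hed hδ))).fun_neg
      exact h
    have h1 := (hasDerivAt_slice_fst hFd t θ).unique hFs
    have h2 := (hasDerivAt_slice_snd hGd t θ).unique hGs
    rw [h1, h2, clm_apply_one_snd (fderiv ℝ e (t, Xv)) ((b₁ - a₁) * θ + a₁),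
      clm_apply_zero_snd (fderiv ℝ m (t, Xv)) (b₀ + b₁ * t - (a₀ + a₁ * t)),
      clm_apply_zero_snd (fderiv ℝ e (t, Xv)) (b₀ + b₁ * t - (a₀ + a₁ * t)), hcons (t, Xv)]
    ring
  -- Green's formula on the box
  have key := integral2_divergence_prod_of_hasFDerivAt F G (fderiv ℝ F) (fderiv ℝ G) t₁ 0 t₂ 1
    hFd.continuous.continuousOn hGd.continuous.continuousOn
    (fun z _ => (hFd z).hasFDerivAt) (fun z _ => (hGd z).hasFDerivAt)
    (by
      have : (fun z : ℝ × ℝ => fderiv ℝ F z (1, 0) + fderiv ℝ G z (0, 1)) = fun _ => 0 :=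
        funext fun z => hdiv z.1 z.2
      rw [this]
      exact integrableOn_zero)
  have hlhs : (∫ t in t₁..t₂, ∫ θ in (0 : ℝ)..1,
      fderiv ℝ F (t, θ) (1, 0) + fderiv ℝ G (t, θ) (0, 1)) = 0 := by
    simp_rw [hdiv]
    simp
  rw [hlhs] at key
  -- evaluate the four boundary terms
  have hG1 : ∀ t, G (t, 1) = -(m (t, b₀ + b₁ * t) + b₁ * e (t, b₀ + b₁ * t)) := by
    intro t
    have h1 : (b₀ + b₁ * t - (a₀ + a₁ * t)) * 1 + (a₀ + a₁ * t) = b₀ + b₁ * t := by ring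
    have h2 : a₁ + (b₁ - a₁) * 1 = b₁ := by ring
    simp only [hG, h1, h2]
  have hG0 : ∀ t, G (t, 0) = -(m (t, a₀ + a₁ * t) + a₁ * e (t, a₀ + a₁ * t)) := by
    intro t
    have h1 : (b₀ + b₁ * t - (a₀ + a₁ * t)) * 0 + (a₀ + a₁ * t) = a₀ + a₁ * t := by ring
    have h2 : a₁ + (b₁ - a₁) * 0 = a₁ := by ring
    simp only [hG, h1, h2]
  have hFint : ∀ t, (∫ θ in (0 : ℝ)..1, F (t, θ))
      = ∫ x in (a₀ + a₁ * t)..(b₀ + b₁ * t), e (t, x) := by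
    intro t
    simp only [hF]
    rw [intervalIntegral.integral_const_mul,
      intervalIntegral.mul_integral_comp_mul_add (f := fun x => e (t, x))]
    congr 1 <;> ring
  rw [hFint, hFint] at key
  simp_rw [hG1, hG0] at key
  have hi1 : IntervalIntegrable (fun t => -(m (t, b₀ + b₁ * t) + b₁ * e (t, b₀ + b₁ * t)))
      volume t₁ t₂ := by
    apply Continuous.intervalIntegrable
    fun_prop
  have hi0 : IntervalIntegrable (fun t => -(m (t, a₀ + a₁ * t) + a₁ * e (t, a₀ + a₁ * t)))
      volume t₁ t₂ := by
    apply Continuous.intervalIntegrable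
    fun_prop
  have hsub := intervalIntegral.integral_sub hi0 hi1
  have hcongr : (∫ t in t₁..t₂, ((m (t, b₀ + b₁ * t) + b₁ * e (t, b₀ + b₁ * t))
      - (m (t, a₀ + a₁ * t) + a₁ * e (t, a₀ + a₁ * t))))
      = ∫ t in t₁..t₂, (-(m (t, a₀ + a₁ * t) + a₁ * e (t, a₀ + a₁ * t))
        - -(m (t, b₀ + b₁ * t) + b₁ * e (t, b₀ + b₁ * t))) := by
    congr 1
    funext t
    ring
  rw [hcongr, hsub]
  linarith

end WaveEnergy

end

end Summit.FinalStateConjecture.FinalStateConjecture.Theorems
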